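import Mathlib
import Summits.Ventures.HodgeRepro2.Hypothesis
import Summits.Ventures.HodgeRepro2.BallActionU21
import Summits.Ventures.HodgeRepro2.DefiniteUnitaryBounded
import Summits.Ventures.HodgeRepro2.BallStabilizerBounded

/-!
# `U(2,1)` acts properly on the ball: uniform bounds on compact sets

`BallStabilizerBounded.lean` bounds the entries of the elements of `U(2,1)` fixing ONE negative
line, through the invariant positive definite form `stabForm w`.  The properness of the action of
`U(2,1)` on `𝔹²` (Shimura, J. Math. Soc. Japan 31 (1979), §4; DR15 §2: `Γ\𝔹²` is Hausdorff, indeed a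
compact complex surface for neat `Γ`) needs the UNIFORM statement: the elements carrying a point of a
compact set `K` into a compact set `L` have entries bounded by a constant depending on `K`, `L`
only.  This file kernel-checks it:

* `stabQuad w v` — the quadratic form `vᴴ (stabForm w) v` as a real function, with its continuity
  and scaling (`stabQuad_smul`);
* `exists_uniform_coercive` — on a compact set `C` of negative vectors, `stabQuad w v ≥ c ‖v‖²` for
  one `c > 0` (minimum of a continuous positive function on `C × S⁵`);
* `exists_uniform_diag_bound` — the diagonal values `stabQuad w e_j` are bounded on `C`;
* `IsInU21.stabQuad_mulVec` — **transfer**: if `α ∈ U(2,1)` carries the negative line `ℂ w` to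
  `ℂ w'`, then `stabQuad w' (α v) = stabQuad w v` for every `v`;
* `exists_uniform_entry_bound` — **the uniform bound**: for compact sets `C`, `C'` of negative
  vectors there is `B` with `‖α i j‖ ≤ B` for every `α ∈ U(2,1)` carrying some line of `C` to some
  line of `C'`.

The translation to the ball, to `Γ ⊆ Γ_N`, and to the Hausdorff property of the quotient is
`BallQuotientHausdorff.lean`.
-/

open Matrix

namespace Summit.Ventures.HodgeRepro2.ShimuraData

/-- The quadratic form of `stabForm w`, as a real-valued function of `v`. -/
noncomputable def stabQuad (w v : Fin 3 → ℂ) : ℝ :=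
  hermJ21 v + (2 / |hermJ21 w|) * ‖hermPair w v‖ ^ 2

/-- `stabQuad w v > 0` for a negative `w` and `v ≠ 0`. -/
theorem stabQuad_pos {w : Fin 3 → ℂ} (hw : hermJ21 w < 0) {v : Fin 3 → ℂ} (hv : v ≠ 0) :
    0 < stabQuad w v :=
  hermJ21_add_pos hw hv

/-- `stabQuad w 0 = 0`. -/
theorem stabQuad_zero (w : Fin 3 → ℂ) : stabQuad w 0 = 0 := by
  unfold stabQuad hermJ21 hermPair
  simp

/-- Scaling: `stabQuad w (a • v) = ‖a‖² stabQuad w v`. -/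
theorem stabQuad_smul (w : Fin 3 → ℂ) (a : ℂ) (v : Fin 3 → ℂ) :
    stabQuad w (a • v) = ‖a‖ ^ 2 * stabQuad w v := by
  unfold stabQuad
  rw [hermJ21_smul, hermPair_smul_right, norm_mul, mul_pow]
  ring

/-- `hermJ21` is continuous. -/
theorem continuous_hermJ21 : Continuous hermJ21 := by
  unfold hermJ21
  fun_prop

/-- `hermPair` is continuous in both arguments. -/
theorem continuous_hermPair :
    Continuous fun p : (Fin 3 → ℂ) × (Fin 3 → ℂ) => hermPair p.1 p.2 := by
  unfold hermPair
  exact (continuous_star.comp continuous_fst).dotProduct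
    (continuous_const.matrix_mulVec continuous_snd)

/-- `stabQuad` is continuous on pairs `(w, v)` with `hermJ21 w ≠ 0`. -/
theorem continuousOn_stabQuad {C : Set (Fin 3 → ℂ)} (hC : ∀ w ∈ C, hermJ21 w < 0)
    (D : Set (Fin 3 → ℂ)) :
    ContinuousOn (fun p : (Fin 3 → ℂ) × (Fin 3 → ℂ) => stabQuad p.1 p.2) (C ×ˢ D) := by
  unfold stabQuad
  have h1 : ContinuousOn (fun p : (Fin 3 → ℂ) × (Fin 3 → ℂ) => (2 : ℝ) / |hermJ21 p.1|)
      (C ×ˢ D) := by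
    refine ContinuousOn.div continuousOn_const
      ((continuous_hermJ21.comp continuous_fst).abs.continuousOn) ?_
    intro p hp
    exact abs_ne_zero.mpr (hC p.1 hp.1).ne
  have h2 : Continuous fun p : (Fin 3 → ℂ) × (Fin 3 → ℂ) => ‖hermPair p.1 p.2‖ ^ 2 :=
    continuous_hermPair.norm.pow 2
  exact ((continuous_hermJ21.comp continuous_snd).continuousOn).add (h1.mul h2.continuousOn)

/-- **Uniform coercivity.**  On a compact set `C` of negative vectors there is `c > 0` with
`stabQuad w v ≥ c ‖v‖²` for every `w ∈ C` and every `v`. -/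
theorem exists_uniform_coercive {C : Set (Fin 3 → ℂ)} (hC : IsCompact C)
    (hCneg : ∀ w ∈ C, hermJ21 w < 0) :
    ∃ c : ℝ, 0 < c ∧ ∀ w ∈ C, ∀ v : Fin 3 → ℂ, c * ‖v‖ ^ 2 ≤ stabQuad w v := by
  rcases C.eq_empty_or_nonempty with hCe | hCne
  · exact ⟨1, one_pos, fun w hw => by simp [hCe] at hw⟩
  -- minimum on `C × S`
  have hS : IsCompact (C ×ˢ Metric.sphere (0 : Fin 3 → ℂ) 1) := hC.prod (isCompact_sphere 0 1)
  have hSne : (C ×ˢ Metric.sphere (0 : Fin 3 → ℂ) 1).Nonempty :=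
    hCne.prod (NormedSpace.sphere_nonempty.mpr zero_le_one)
  obtain ⟨p₀, hp₀, hmin⟩ := hS.exists_isMinOn hSne (continuousOn_stabQuad hCneg _)
  rw [isMinOn_iff] at hmin
  have hv₀ : p₀.2 ≠ 0 := by
    have := mem_sphere_zero_iff_norm.mp hp₀.2
    intro h
    rw [h, norm_zero] at this
    exact zero_ne_one this
  refine ⟨stabQuad p₀.1 p₀.2, stabQuad_pos (hCneg _ hp₀.1) hv₀, fun w hw v => ?_⟩
  rcases eq_or_ne v 0 with rfl | hv
  · rw [stabQuad_zero, norm_zero]; simp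
  · set u : Fin 3 → ℂ := ((‖v‖⁻¹ : ℝ) : ℂ) • v with hu
    have hu1 : u ∈ Metric.sphere (0 : Fin 3 → ℂ) 1 := by
      rw [mem_sphere_zero_iff_norm, hu, norm_smul, Complex.norm_real, Real.norm_eq_abs,
        abs_of_pos (inv_pos.mpr (norm_pos_iff.mpr hv)), inv_mul_cancel₀ (norm_ne_zero_iff.mpr hv)]
    have h1 := hmin (w, u) ⟨hw, hu1⟩
    have h2 : stabQuad w u = (‖v‖ ^ 2)⁻¹ * stabQuad w v := by
      rw [hu, stabQuad_smul, Complex.norm_real, Real.norm_eq_abs,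
        abs_of_pos (inv_pos.mpr (norm_pos_iff.mpr hv)), inv_pow]
    have hv2 : 0 < ‖v‖ ^ 2 := by positivity
    rw [h2] at h1
    have := mul_le_mul_of_nonneg_left h1 hv2.le
    rw [← mul_assoc, mul_inv_cancel₀ hv2.ne', one_mul] at this
    rw [mul_comm]
    exact this

/-- **Uniform bound on the diagonal values.**  On a compact set `C` of negative vectors the values
`stabQuad w e_j` are bounded. -/
theorem exists_uniform_diag_bound {C : Set (Fin 3 → ℂ)} (hC : IsCompact C)
    (hCneg : ∀ w ∈ C, hermJ21 w < 0) :
    ∃ M : ℝ, ∀ w ∈ C, ∀ j : Fin 3, stabQuad w (Pi.single j 1) ≤ M := by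
  have hE : IsCompact (C ×ˢ Set.range fun j : Fin 3 => (Pi.single j (1 : ℂ) : Fin 3 → ℂ)) :=
    hC.prod (Set.finite_range _).isCompact
  obtain ⟨M, hM⟩ := hE.exists_bound_of_continuousOn (continuousOn_stabQuad hCneg _)
  refine ⟨M, fun w hw j => ?_⟩
  have := hM (w, Pi.single j 1) ⟨hw, ⟨j, rfl⟩⟩
  exact (le_abs_self _).trans (by simpa using this)

/-- `αᴴ (J w') = c⁻¹ (J w)` when `α ∈ U(2,1)` and `α w = c w'`. -/
theorem IsInU21.conjTranspose_mulVec_J21_mulVec' {α : Matrix (Fin 3) (Fin 3) ℂ} (hα : IsInU21 α)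
    {w w' : Fin 3 → ℂ} {c : ℂ} (h : α *ᵥ w = c • w') (hc : c ≠ 0) :
    αᴴ *ᵥ (J21 *ᵥ w') = c⁻¹ • (J21 *ᵥ w) := by
  have e1 : (αᴴ * J21 * α) *ᵥ w = J21 *ᵥ w := by rw [hα]
  rw [← mulVec_mulVec, ← mulVec_mulVec, h, mulVec_smul, mulVec_smul] at e1
  rw [eq_inv_smul_iff₀ hc]
  exact e1

/-- **Transfer.**  If `α ∈ U(2,1)` carries the negative line `ℂ w` to the negative line `ℂ w'`,
then `stabQuad w' (α v) = stabQuad w v` for every `v`. -/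
theorem IsInU21.stabQuad_mulVec {α : Matrix (Fin 3) (Fin 3) ℂ} (hα : IsInU21 α)
    {w w' : Fin 3 → ℂ} (hw : hermJ21 w < 0) (hw' : hermJ21 w' < 0) {c : ℂ}
    (h : α *ᵥ w = c • w') (v : Fin 3 → ℂ) : stabQuad w' (α *ᵥ v) = stabQuad w v := by
  -- `‖c‖² hermJ21 w' = hermJ21 w`
  have hc2 : ‖c‖ ^ 2 * hermJ21 w' = hermJ21 w := by
    have := hα.hermJ21_mulVec w
    rw [h, hermJ21_smul] at this
    exact this
  have hc : c ≠ 0 := by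
    rintro rfl
    rw [norm_zero, zero_pow two_ne_zero, zero_mul] at hc2
    exact hw.ne hc2.symm
  have hJw := hα.conjTranspose_mulVec_J21_mulVec' h hc
  -- `hermPair w' (α v) = star c⁻¹ * hermPair w v`
  have hpair : hermPair w' (α *ᵥ v) = star c⁻¹ * hermPair w v := by
    rw [← star_J21_mulVec_dotProduct, dotProduct_mulVec, ← conjTranspose_conjTranspose α,
      ← star_mulVec, hJw, star_smul, smul_dotProduct, smul_eq_mul, star_J21_mulVec_dotProduct]
  unfold stabQuad
  rw [hα.hermJ21_mulVec, hpair, norm_mul, norm_star, norm_inv, mul_pow, inv_pow,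
    abs_of_neg hw, abs_of_neg hw']
  have hc0 : 0 < ‖c‖ ^ 2 := by positivity
  have hw0 : hermJ21 w ≠ 0 := hw.ne
  have hw0' : hermJ21 w' ≠ 0 := hw'.ne
  field_simp
  linear_combination (2 * ‖hermPair w v‖ ^ 2) * hc2

/-- **The uniform entry bound.**  For compact sets `C`, `C'` of negative vectors there is a
constant `B` bounding the entries of every `α ∈ U(2,1)` which carries some line `ℂ w`, `w ∈ C`, to
some line `ℂ w'`, `w' ∈ C'`. -/
theorem exists_uniform_entry_bound {C C' : Set (Fin 3 → ℂ)} (hC : IsCompact C)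
    (hCneg : ∀ w ∈ C, hermJ21 w < 0) (hC' : IsCompact C') (hC'neg : ∀ w ∈ C', hermJ21 w < 0) :
    ∃ B : ℝ, ∀ α : Matrix (Fin 3) (Fin 3) ℂ, IsInU21 α → ∀ w ∈ C, ∀ w' ∈ C',
      (∃ c : ℂ, α *ᵥ w = c • w') → ∀ i j, ‖α i j‖ ≤ B := by
  obtain ⟨c', hc'pos, hc'⟩ := exists_uniform_coercive hC' hC'neg
  obtain ⟨M, hM⟩ := exists_uniform_diag_bound hC hCneg
  refine ⟨Real.sqrt (max M 0 / c'), fun α hα w hw w' hw' ⟨c, hc⟩ i j => ?_⟩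
  -- the `j`-th column of `α`
  set a : Fin 3 → ℂ := α *ᵥ Pi.single j 1 with ha
  have haij : a i = α i j := by
    rw [ha, Matrix.mulVec_single_one]; rfl
  have h1 : c' * ‖a‖ ^ 2 ≤ stabQuad w' a := hc' w' hw' a
  have h2 : stabQuad w' a = stabQuad w (Pi.single j 1) :=
    hα.stabQuad_mulVec (hCneg w hw) (hC'neg w' hw') hc _
  have h3 : stabQuad w (Pi.single j 1) ≤ M := hM w hw j
  have h4 : ‖a‖ ^ 2 ≤ max M 0 / c' := by
    rw [le_div_iff₀ hc'pos]
    linarith [le_max_left M 0]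
  have h5 : ‖α i j‖ ≤ ‖a‖ := by rw [← haij]; exact norm_le_pi_norm a i
  rw [Real.le_sqrt (norm_nonneg _) (by positivity)]
  calc ‖α i j‖ ^ 2 ≤ ‖a‖ ^ 2 := by gcongr
    _ ≤ max M 0 / c' := h4

end Summit.Ventures.HodgeRepro2.ShimuraData
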